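import Summits.HubbardSuperconductivity.HubbardSuperconductivity.Theorems.AnisotropyChordTransferFibre3KT1Targets
import Summits.HubbardSuperconductivity.HubbardSuperconductivity.Theorems.AnisotropyChordTransferFibre3Lam2Bounds
import Summits.HubbardSuperconductivity.HubbardSuperconductivity.Theorems.AnisotropyChordTransferFibre3GroundState

/-!
# Route `AnisotropyChord` / H0 rotor rung: PartN33 Layer C — `GradSNormClosed` PROVED (and the `x ↔ y` symmetry of the ground profile)

PartN33 = `…Fibre3KT1Targets` (theory seat `hubbard-h0-rotor-theory-1`, memo 21 §297(A)/§298(a)).  This file proves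

* **`ground_swap (2 ≤ L)`** — the ground two-magnon profile is symmetric under the exchange of the two lattice axes,
  `f (y, x) = f (x, y)`: `h := f − f∘swap` solves the (linear, swap-invariant) two-magnon equation and vanishes at the origin,
  so `|h|` is a constrained minimiser (`qf_abs_le` + minimality); a zero of a non-negative minimiser spreads to its neighbours
  (`nbSum_eq_zero_of_min`) and the punctured torus is connected (`torus_connect`); `h` vanishes on the diagonal point `(1,1)`.
* **`gradSNormClosed_holds (3 ≤ L) (Δ) : GradSNormClosed L Δ`** — the closed form
  `‖D_e s‖² = 2η_eff·(1 − Δf_nn + ‖h‖²/V)`, `‖h‖² = 1 + ‖s‖² − (1 − Δf_nn)²`, for each nearest neighbour `e`: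
  `‖D_e s‖² = 2Σ_r s(r)(s(r) − s(r+e))` is the same number for the four `e` (reindexing and `ground_swap`), the four add up to
  `2Σ_r s·(−Δ_lattice s)`, and `−Δ_lattice s = λ₂(V·δ₀ − f)` by the two-magnon equation, `f = f_nn` on the neighbours and the
  sum rule `λ₂V = 4(1−Δ)f_nn` (`lam2_sum_rule`).

`3 ≤ L` is needed for the four nearest-neighbour vectors to be distinct (the sum rule and the neighbour bookkeeping).
Nothing here proves superconductivity in the Hubbard model; these are helper lemmas of ONE conditional reduction
(rung stmt-HubbardSuperconductivity-19089).  Prover seat `hubbard-h0-rotor-p3` g0; `--supports stmt-HubbardSuperconductivity-19089`.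
-/

set_option linter.dupNamespace false
set_option autoImplicit false

noncomputable section

open scoped BigOperators
open Complex

namespace Summit.HubbardSuperconductivity.HubbardSuperconductivity.Theorems.AnisotropyChord.Transfer.Fibre3

variable (L : ℕ) [NeZero L]

/-! ## The coordinate swap `(x, y) ↦ (y, x)` on the torus -/

omit [NeZero L] in
/-- `(r₂, r₁) = (a, b) ↔ r = (b, a)`. [folklore] -/
theorem swap_eq_mk_iff (r : Tor L) (a b : ZMod L) : ((r.2, r.1) : Tor L) = (a, b) ↔ r = (b, a) := by
  obtain ⟨x, y⟩ := r
  simp only [Prod.mk.injEq]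
  exact and_comm

omit [NeZero L] in
/-- `(r₂, r₁) = 0 ↔ r = 0`. [folklore] -/
theorem swap_eq_zero_iff (r : Tor L) : ((r.2, r.1) : Tor L) = 0 ↔ r = 0 := by
  obtain ⟨x, y⟩ := r
  simp only [Prod.mk_eq_zero]
  exact and_comm

omit [NeZero L] in
/-- the nearest-neighbour indicator is swap-invariant. [folklore] -/
theorem IsNN_swap (r : Tor L) : IsNN L (r.2, r.1) = IsNN L r := by
  unfold IsNN
  rw [Bool.decide_congr (swap_eq_mk_iff L r 1 0), Bool.decide_congr (swap_eq_mk_iff L r (-1) 0),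
    Bool.decide_congr (swap_eq_mk_iff L r 0 1), Bool.decide_congr (swap_eq_mk_iff L r 0 (-1))]
  cases decide (r = ((1 : ZMod L), 0)) <;> cases decide (r = ((-1 : ZMod L), 0)) <;>
    cases decide (r = ((0 : ZMod L), 1)) <;> cases decide (r = ((0 : ZMod L), -1)) <;> rfl

omit [NeZero L] in
/-- `nnInd` is swap-invariant. [folklore] -/
theorem nnInd_swap (r : Tor L) : nnInd L (r.2, r.1) = nnInd L r := by
  unfold nnInd; rw [IsNN_swap]

omit [NeZero L] in
/-- the neighbour sum of the swapped function is the swapped neighbour sum. [folklore] -/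
theorem nbSum_swap (g : Tor L → ℝ) (r : Tor L) :
    nbSum L (fun u => g (u.2, u.1)) r = nbSum L g (r.2, r.1) := by
  have k1 : (((r + ex L).2, (r + ex L).1) : Tor L) = (r.2, r.1) + ey L := by unfold ex ey; ext <;> simp
  have k2 : (((r + -ex L).2, (r + -ex L).1) : Tor L) = (r.2, r.1) + -ey L := by unfold ex ey; ext <;> simp
  have k3 : (((r + ey L).2, (r + ey L).1) : Tor L) = (r.2, r.1) + ex L := by unfold ex ey; ext <;> simp
  have k4 : (((r + -ey L).2, (r + -ey L).1) : Tor L) = (r.2, r.1) + -ex L := by unfold ex ey; ext <;> simp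
  unfold nbSum
  simp only
  rw [k1, k2, k3, k4]
  ring

/-! ## The two-magnon equation in neighbour-sum form -/

/-- the two-magnon equation off the origin: `(4 − Δ·1_NN(r)) f(r) − Σ_e f(r+e) = λ₂ f(r)`. [folklore] -/
theorem twoMagnon_eq_nbSum {Δ lam2 : ℝ} {f : Tor L → ℝ} (hf : IsTwoMagnon L Δ lam2 f) (r : Tor L) (hr : r ≠ 0) :
    (4 - Δ * nnInd L r) * f r - nbSum L f r = lam2 * f r := by
  have h := hf.2.2.2.2 r hr
  simp only [nnList_map_sum] at h
  unfold nnInd nbSum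
  linear_combination h

/-- the swapped profile solves the same equation. [folklore] -/
theorem twoMagnon_eq_nbSum_swap {Δ lam2 : ℝ} {f : Tor L → ℝ} (hf : IsTwoMagnon L Δ lam2 f) (r : Tor L) (hr : r ≠ 0) :
    (4 - Δ * nnInd L r) * f (r.2, r.1) - nbSum L (fun u => f (u.2, u.1)) r = lam2 * f (r.2, r.1) := by
  rw [nbSum_swap, ← nnInd_swap]
  exact twoMagnon_eq_nbSum L hf (r.2, r.1) (by rw [Ne, swap_eq_zero_iff]; exact hr)

/-- for a solution of the equation vanishing at the origin, `Q(h) = λ₂ Σ h²`. [folklore] -/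
theorem qf_of_eq {Δ lam2 : ℝ} {h : Tor L → ℝ} (h0 : h 0 = 0)
    (heq : ∀ r : Tor L, r ≠ 0 → (4 - Δ * nnInd L r) * h r - nbSum L h r = lam2 * h r) :
    twoMagnonQF L Δ h = lam2 * ∑ r : Tor L, h r ^ 2 := by
  rw [twoMagnonQF_eq, Finset.mul_sum]
  refine Finset.sum_congr rfl fun r _ => ?_
  by_cases hr : r = 0
  · rw [hr, h0]; ring
  · have e := heq r hr
    calc (4 - Δ * nnInd L r) * h r ^ 2 - h r * nbSum L h r
        = h r * ((4 - Δ * nnInd L r) * h r - nbSum L h r) := by ring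
      _ = h r * (lam2 * h r) := by rw [e]
      _ = lam2 * h r ^ 2 := by ring

/-! ## The `x ↔ y` symmetry of the ground profile -/

/-- ★ **the ground two-magnon profile is swap-symmetric:** `f (y, x) = f (x, y)` (`L ≥ 2`). [folklore] -/
theorem ground_swap (hL : 2 ≤ L) {Δ lam2 : ℝ} {f : Tor L → ℝ} (hf : IsGroundTwoMagnon L Δ lam2 f) (r : Tor L) :
    f (r.2, r.1) = f r := by
  classical
  obtain ⟨htm, _, hmin⟩ := hf
  have h0 : f 0 = 0 := htm.1
  have h00 : f (((0 : Tor L)).2, ((0 : Tor L)).1) = 0 := by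
    rw [show ((((0 : Tor L)).2, ((0 : Tor L)).1) : Tor L) = 0 from rfl]; exact h0
  set h : Tor L → ℝ := fun u => f u - f (u.2, u.1) with hh
  -- `h` solves the equation and vanishes at the origin
  have hz : h 0 = 0 := by simp only [hh]; rw [h00, h0]; ring
  have heqh : ∀ u : Tor L, u ≠ 0 → (4 - Δ * nnInd L u) * h u - nbSum L h u = lam2 * h u := by
    intro u hu
    have e1 := twoMagnon_eq_nbSum L htm u hu
    have e2 := twoMagnon_eq_nbSum_swap L htm u hu
    have hnb : nbSum L h u = nbSum L f u - nbSum L (fun w => f (w.2, w.1)) u := by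
      simp only [hh]; unfold nbSum; ring
    rw [hnb]; simp only [hh]
    linear_combination e1 - e2
  have hQh := qf_of_eq L hz heqh
  -- `|h|` is a minimiser
  set g : Tor L → ℝ := fun u => |h u| with hg
  have hg0 : ∀ u, 0 ≤ g u := fun u => abs_nonneg _
  have hgz : g 0 = 0 := by simp only [hg]; rw [hz, abs_zero]
  have hQg : twoMagnonQF L Δ g = lam2 * ∑ u : Tor L, g u ^ 2 := by
    have hle := qf_abs_le L Δ h
    have hge := hmin g hgz
    have hsq : ∑ u : Tor L, g u ^ 2 = ∑ u : Tor L, h u ^ 2 := Finset.sum_congr rfl fun u _ => sq_abs (h u)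
    rw [hsq] at hge ⊢
    have hle' : twoMagnonQF L Δ g ≤ twoMagnonQF L Δ h := hle
    linarith
  -- zeros of `g` propagate
  have hnb : ∀ u : Tor L, u ≠ 0 → g u = 0 → nbSum L g u = 0 :=
    fun u hu hgu => nbSum_eq_zero_of_min L hg0 hmin hQg hgz hu hgu
  have hx : ∀ u : Tor L, u ≠ 0 → g u = 0 → u + ex L ≠ 0 → g (u + ex L) = 0 := by
    intro u hu hgu _
    have e := hnb u hu hgu
    unfold nbSum at e
    have := hg0 (u + ex L); have := hg0 (u + -ex L); have := hg0 (u + ey L); have := hg0 (u + -ey L)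
    linarith
  have hy : ∀ u : Tor L, u ≠ 0 → g u = 0 → u + ey L ≠ 0 → g (u + ey L) = 0 := by
    intro u hu hgu _
    have e := hnb u hu hgu
    unfold nbSum at e
    have := hg0 (u + ex L); have := hg0 (u + -ex L); have := hg0 (u + ey L); have := hg0 (u + -ey L)
    linarith
  -- the diagonal point `(1,1)` is a zero of `g`
  have h1 : (1 : ZMod L) ≠ 0 := by
    haveI : Fact (1 < L) := ⟨by omega⟩
    exact one_ne_zero
  have h11 : (((1 : ZMod L), (1 : ZMod L)) : Tor L) ≠ 0 := fun e => h1 (congrArg Prod.fst e)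
  have hg11 : g ((1 : ZMod L), 1) = 0 := by
    simp only [hg, hh]; rw [sub_self, abs_zero]
  by_cases hr : r = 0
  · rw [hr, h00, h0]
  · have key := torus_connect L hL (fun u => g u = 0) hx hy h11 hr hg11
    have : |f r - f (r.2, r.1)| = 0 := key
    rw [abs_eq_zero, sub_eq_zero] at this
    exact this.symm

/-! ## Neighbour bookkeeping (`L ≥ 3`: the four neighbour vectors are distinct) -/

omit [NeZero L] in
/-- `Σ_{e} [r + e = 0] = 1_NN(r)` over the four neighbour vectors (`L ≥ 3`). [folklore] -/
theorem sum_ind_add_eq_zero (hL : 3 ≤ L) (r : Tor L) :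
    (if r + ex L = 0 then (1 : ℝ) else 0) + (if r + -ex L = 0 then 1 else 0) + (if r + ey L = 0 then 1 else 0)
        + (if r + -ey L = 0 then 1 else 0) = nnInd L r := by
  obtain ⟨d1, d2, d3, d4, d5, d6⟩ := nn_distinct L hL
  have i1 : (r + ex L = 0) ↔ (r = -ex L) := add_eq_zero_iff_eq_neg
  have i2 : (r + -ex L = 0) ↔ (r = ex L) := by rw [add_eq_zero_iff_eq_neg, neg_neg]
  have i3 : (r + ey L = 0) ↔ (r = -ey L) := add_eq_zero_iff_eq_neg
  have i4 : (r + -ey L = 0) ↔ (r = ey L) := by rw [add_eq_zero_iff_eq_neg, neg_neg]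
  simp only [i1, i2, i3, i4]
  unfold nnInd
  by_cases hnn : IsNN L r = true
  · rw [if_pos hnn]
    rcases eq_of_isNN L hnn with h | h | h | h <;> subst h
    · rw [if_neg d1, if_pos rfl, if_neg d3, if_neg d2]; norm_num
    · rw [if_pos rfl, if_neg (Ne.symm d1), if_neg d5, if_neg d4]; norm_num
    · rw [if_neg (Ne.symm d4), if_neg (Ne.symm d2), if_neg d6, if_pos rfl]; norm_num
    · rw [if_neg (Ne.symm d5), if_neg (Ne.symm d3), if_pos rfl, if_neg (Ne.symm d6)]; norm_num
  · rw [if_neg hnn]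
    have n1 : r ≠ -ex L := fun h => hnn (by rw [h, IsNN_neg]; exact isNN_ex L)
    have n2 : r ≠ ex L := fun h => hnn (by rw [h]; exact isNN_ex L)
    have n3 : r ≠ -ey L := fun h => hnn (by rw [h, IsNN_neg]; exact isNN_ey L)
    have n4 : r ≠ ey L := fun h => hnn (by rw [h]; exact isNN_ey L)
    rw [if_neg n1, if_neg n2, if_neg n3, if_neg n4]; norm_num

/-- on the neighbours the profile takes the value `f(x̂)`: `1_NN(r)·f(r) = f(x̂)·1_NN(r)`. [folklore] -/
theorem nnInd_mul_eq {Δ lam2 : ℝ} {f : Tor L → ℝ} (hf : IsTwoMagnon L Δ lam2 f) (r : Tor L) :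
    nnInd L r * f r = f (K1 L) * nnInd L r := by
  have hnn := hf.2.1
  unfold nnInd
  by_cases h : IsNN L r = true
  · rw [if_pos h]
    rcases eq_of_isNN L h with e | e | e | e <;> rw [e]
    · rw [hnn _ (by unfold nnList ex; simp)]; ring
    · rw [hnn _ (by rw [← neg_ex]; unfold nnList; simp)]; ring
    · rw [hnn _ (by unfold nnList ey; simp)]; ring
    · rw [hnn _ (by rw [← neg_ey]; unfold nnList; simp)]; ring
  · rw [if_neg h]; ring

/-! ## `GradSNormClosed` -/

/-- ★ **`GradSNormClosed L Δ` holds for `L ≥ 3`.** [folklore] -/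
theorem gradSNormClosed_holds (hL : 3 ≤ L) (Δ : ℝ) : GradSNormClosed L Δ := by
  classical
  intro lam2 f hf e he
  have hL2 : 2 ≤ L := by omega
  have hsw := ground_swap L hL2 hf
  have htm := hf.1
  have h0 : f 0 = 0 := htm.1
  have hnn := htm.2.1
  have hsum := htm.2.2.2.1
  have hrule := lam2_sum_rule L hL htm
  set V : ℝ := (L : ℝ) ^ 2 with hV
  have hVpos : 0 < V := by
    have : (0 : ℝ) < L := by exact_mod_cast (show 0 < L by omega)
    positivity
  set fnn : ℝ := f (K1 L) with hfnn
  set s : Tor L → ℝ := sfun' L Δ f with hs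
  -- values on the four neighbours
  have f1 : f (ex L) = fnn := hnn _ (by unfold nnList ex; simp)
  have f2 : f (-ex L) = fnn := hnn _ (by rw [← neg_ex]; unfold nnList; simp)
  have f3 : f (ey L) = fnn := hnn _ (by unfold nnList ey; simp)
  have f4 : f (-ey L) = fnn := hnn _ (by rw [← neg_ey]; unfold nnList; simp)
  obtain ⟨hex0, hey0, _⟩ := exy_ne L hL2
  have hex0' : -ex L ≠ 0 := neg_ne_zero.mpr hex0
  have hey0' : -ey L ≠ 0 := neg_ne_zero.mpr hey0
  -- the values of `s`
  have sall : ∀ r : Tor L, s r = 1 - f r - (if r = 0 then Δ * fnn else 0) := by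
    intro r
    rw [hs]
    simp only [sfun']
    by_cases hr : r = 0
    · rw [if_pos hr, if_pos hr, hr, h0]; ring
    · rw [if_neg hr, if_neg hr]; ring
  have s0 : s 0 = 1 - Δ * fnn := by
    have h := sall 0
    rw [if_pos rfl, h0] at h
    linarith
  have sr : ∀ r : Tor L, r ≠ 0 → s r = 1 - f r := by
    intro r hr
    have h := sall r
    rw [if_neg hr] at h
    linarith
  -- `s` is swap-symmetric
  have ssw : ∀ r : Tor L, s (r.2, r.1) = s r := by
    intro r
    rw [sall, sall, hsw r]
    simp only [swap_eq_zero_iff]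
  -- (1) ‖D_e s‖² = 2·P(e), P(e) := Σ_r s(r)(s(r) − s(r+e))
  have corr_shift : ∀ d : Tor L, ∑ r : Tor L, s r * s (r - d) = ∑ r : Tor L, s r * s (r + d) := by
    intro d
    rw [← Fintype.sum_equiv (Equiv.addRight d) (fun r => s (r + d) * s r) (fun r => s r * s (r - d))
      (fun r => by simp only [Equiv.coe_addRight, add_sub_cancel_right])]
    exact Finset.sum_congr rfl fun r _ => mul_comm _ _
  have grad_eq : ∀ d : Tor L, ∑ r : Tor L, Dgrad L s d r ^ 2 = 2 * ∑ r : Tor L, s r * (s r - s (r + d)) := by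
    intro d
    unfold Dgrad
    have h1 : ∑ r : Tor L, s (r - d) ^ 2 = ∑ r : Tor L, s r ^ 2 :=
      Fintype.sum_equiv (Equiv.subRight d) _ _ (fun r => rfl)
    have e3 : ∑ r : Tor L, (s r - s (r - d)) ^ 2
        = ∑ r : Tor L, s r ^ 2 + ∑ r : Tor L, s (r - d) ^ 2 - 2 * ∑ r : Tor L, s r * s (r - d) := by
      rw [Finset.mul_sum, ← Finset.sum_add_distrib, ← Finset.sum_sub_distrib]
      refine Finset.sum_congr rfl fun r _ => ?_; ring
    have e4 : ∑ r : Tor L, s r * (s r - s (r + d)) = ∑ r : Tor L, s r ^ 2 - ∑ r : Tor L, s r * s (r + d) := by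
      rw [← Finset.sum_sub_distrib]; refine Finset.sum_congr rfl fun r _ => ?_; ring
    rw [e3, e4, h1, corr_shift d]; ring
  -- (2) P(−e) = P(e)
  have P_neg : ∀ d : Tor L,
      ∑ r : Tor L, s r * (s r - s (r + -d)) = ∑ r : Tor L, s r * (s r - s (r + d)) := by
    intro d
    have e4 : ∀ d' : Tor L,
        ∑ r : Tor L, s r * (s r - s (r + d')) = ∑ r : Tor L, s r ^ 2 - ∑ r : Tor L, s r * s (r + d') := by
      intro d'; rw [← Finset.sum_sub_distrib]; refine Finset.sum_congr rfl fun r _ => ?_; ring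
    rw [e4, e4]
    simp only [← sub_eq_add_neg]
    rw [corr_shift d]
  -- (3) P(e_y) = P(eₓ) by the swap symmetry
  have P_swap : ∑ r : Tor L, s r * (s r - s (r + ey L)) = ∑ r : Tor L, s r * (s r - s (r + ex L)) := by
    have k : ∀ r : Tor L, (((r + ey L).2, (r + ey L).1) : Tor L) = (r.2, r.1) + ex L := by
      intro r; unfold ex ey; ext <;> simp
    have hpt : ∀ r : Tor L, s r * (s r - s (r + ey L)) = s (r.2, r.1) * (s (r.2, r.1) - s ((r.2, r.1) + ex L)) := by
      intro r; rw [ssw r, ← k r, ssw (r + ey L)]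
    rw [Finset.sum_congr rfl fun r _ => hpt r]
    exact Fintype.sum_equiv (Equiv.prodComm (ZMod L) (ZMod L)) _ _ (fun r => rfl)
  -- (4) the four `P` add up to `Σ_r s(r)·(4s(r) − Σ_e s(r+e))`
  have P4 : ∑ r : Tor L, s r * (s r - s (r + ex L)) + ∑ r : Tor L, s r * (s r - s (r + -ex L))
        + ∑ r : Tor L, s r * (s r - s (r + ey L)) + ∑ r : Tor L, s r * (s r - s (r + -ey L))
      = ∑ r : Tor L, s r * (4 * s r - nbSum L s r) := by
    rw [← Finset.sum_add_distrib, ← Finset.sum_add_distrib, ← Finset.sum_add_distrib]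
    refine Finset.sum_congr rfl fun r _ => ?_
    unfold nbSum; ring
  -- (5) the discrete Laplacian of `s`: `4s(r) − Σ_e s(r+e) = λ₂·(V·δ₀(r) − f(r))`
  have lap : ∀ r : Tor L, s r * (4 * s r - nbSum L s r)
      = lam2 * ((if r = 0 then V * (1 - Δ * fnn) else 0) + (f r ^ 2 - f r)) := by
    intro r
    by_cases hr : r = 0
    · rw [hr, if_pos rfl, h0, s0]
      have hnb : nbSum L s 0 = 4 * (1 - fnn) := by
        unfold nbSum
        rw [zero_add, zero_add, zero_add, zero_add, sr _ hex0, sr _ hex0', sr _ hey0, sr _ hey0', f1, f2, f3, f4]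
        ring
      rw [hnb]
      have : 4 * (1 - Δ * fnn) - 4 * (1 - fnn) = lam2 * V := by rw [hV, hrule]; ring
      rw [this]; ring
    · rw [if_neg hr, sr r hr]
      have hnb : nbSum L s r = 4 - nbSum L f r - Δ * fnn * nnInd L r := by
        rw [← sum_ind_add_eq_zero L hL r]
        unfold nbSum
        rw [sall (r + ex L), sall (r + -ex L), sall (r + ey L), sall (r + -ey L)]
        have hite : ∀ u : Tor L, (if u = 0 then Δ * fnn else 0) = Δ * fnn * (if u = 0 then (1 : ℝ) else 0) := by
          intro u; split_ifs <;> ring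
        rw [hite, hite, hite, hite]
        ring
      have heq := twoMagnon_eq_nbSum L htm r hr
      have hnnv := nnInd_mul_eq L htm r
      rw [hnb]
      have : 4 * (1 - f r) - (4 - nbSum L f r - Δ * fnn * nnInd L r) = -(lam2 * f r) := by
        have e1 : 4 * f r - nbSum L f r = lam2 * f r + Δ * (nnInd L r * f r) := by linear_combination heq
        rw [hnnv] at e1
        linear_combination -e1
      rw [this]; ring
  -- (6) the total
  have hsumf : ∑ r : Tor L, f r = V := by rw [hV]; exact hsum
  have total : ∑ r : Tor L, s r * (4 * s r - nbSum L s r)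
      = lam2 * (V * (1 - Δ * fnn) + ∑ r : Tor L, f r ^ 2 - V) := by
    rw [Finset.sum_congr rfl fun r _ => lap r, ← Finset.mul_sum, Finset.sum_add_distrib, Finset.sum_ite_eq' Finset.univ (0 : Tor L),
      Finset.sum_sub_distrib, hsumf]
    simp only [Finset.mem_univ, if_true]
    ring
  -- (7) ‖s‖² in terms of ‖f‖²
  have hcard : (Fintype.card (Tor L) : ℝ) = V := by
    rw [hV, Fintype.card_prod, ZMod.card]; push_cast; ring
  have snorm : ∑ r : Tor L, s r ^ 2 = ∑ r : Tor L, f r ^ 2 - V + (1 - Δ * fnn) ^ 2 - 1 := by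
    have hpt : ∀ r : Tor L, s r ^ 2 = (f r ^ 2 - 2 * f r + 1) + (if r = 0 then (1 - Δ * fnn) ^ 2 - 1 else 0) := by
      intro r
      rw [sall r]
      by_cases hr : r = 0
      · rw [if_pos hr, if_pos hr, hr, h0]; ring
      · rw [if_neg hr, if_neg hr]; ring
    rw [Finset.sum_congr rfl fun r _ => hpt r, Finset.sum_add_distrib, Finset.sum_ite_eq' Finset.univ (0 : Tor L),
      Finset.sum_add_distrib, Finset.sum_sub_distrib, Finset.sum_const, Finset.card_univ, nsmul_eq_mul, hcard,
      ← Finset.mul_sum, hsumf]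
    simp only [Finset.mem_univ, if_true, mul_one]
    ring
  -- (8) the given `e` is one of the four neighbours: its `P` is `P(eₓ)`
  have hPe : ∑ r : Tor L, s r * (s r - s (r + e)) = ∑ r : Tor L, s r * (s r - s (r + ex L)) := by
    simp only [nnList, List.mem_cons, List.mem_nil_iff, or_false] at he
    rcases he with he | he | he | he
    · rw [he]; rfl
    · rw [he, neg_ex, P_neg]
    · rw [he]; exact P_swap
    · rw [he, neg_ey, P_neg, P_swap]
  have four : 4 * ∑ r : Tor L, s r * (s r - s (r + ex L))
      = lam2 * (V * (1 - Δ * fnn) + ∑ r : Tor L, f r ^ 2 - V) := by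
    rw [← total, ← P4, P_neg, P_swap, P_neg, P_swap]; ring
  -- assemble
  rw [grad_eq e, hPe, snorm]
  unfold etaEff
  rw [← hV, div_eq_mul_inv _ V]
  have hVinv : V * V⁻¹ = 1 := mul_inv_cancel₀ hVpos.ne'
  linear_combination (1 / 2 : ℝ) * four - (lam2 / 2 * (∑ r : Tor L, f r ^ 2 - V)) * hVinv

end Summit.HubbardSuperconductivity.HubbardSuperconductivity.Theorems.AnisotropyChord.Transfer.Fibre3

end
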